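import Mathlib
import Literature.Combinatorics.Additive.RestrictedSumsetsInRootsOfUnityBound
import Summits.ValiantsHypothesis.ValiantsHypothesis.Theorems.FeketeSOSCharPSparseSOSSumCliquePolynomialMethod
import Literature.NumberTheory.QuadraticFields.KroneckerSplitting

/-!
# Crux `FeketeSOS.CharPSparseSOS` (stmt-ValiantsHypothesis-14989) — the polynomial method on RESTRICTED sum-cliques:
Yip's diagonal cure reaches exactly the counting bound (lead c8)

Every line on this crux reduces it to (CORE): a weak-Sidon restricted Paley sum-clique `Q ⊂ 𝔽_p` (`a + b` a non-zero
quadratic residue for all `a ≠ b` in `Q`, restricted sums pairwise distinct) has `|Q| ≤ √p − p^δ/2 + 9`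
(`coreSumClique_of_charPSparseSOS`, p146769), against the counting bound `|Q|(|Q|−1)/2 ≤ (p−1)/2`.  The crux notes
list four classical tools with their exact reach on (CORE) (counting, completion p140731, Stepanov–Hanson–Petridis
p139086/p139743, parity p149597), all silent on the ANTI-DIAGONAL class `Q⁺ = ∅` (`Q⁺ = {a ∈ Q : (2a|p) = 1}`).

This file adds the fifth row, kernel-checked: **Stepanov's method with the diagonal cured by the factor `(X − a)^m`**
(Yip 2025, Prop. 3.1 — `Literature.Combinatorics.Additive.Yip`, landed with this file) gives, for a restricted
sum-clique of ODD size with at least one bad diagonal and WITHOUT any Sidon hypothesis,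

  `|Q|(|Q|−1)/2 + |Q⁺| ≤ (p−1)/2`                       (`sumClique_choose_two_add_card_good_le`),

i.e. exactly the weak-Sidon counting bound, Sidon-free, plus one unit per good diagonal.  Consequences:
* `sumClique_card_good_le_deficiency` — a restricted sum-clique of odd size within `m` of the counting bound
  (`(p−1)/2 ≤ |Q|(|Q|−1)/2 + m`) has at most `m` good diagonals: NEAR-EXTREMAL RESTRICTED SUM-CLIQUES ARE ANTI-DIAGONAL
  up to `m` points with no Sidon hypothesis (parity, p149597, gives `2|Q⁺| ≤ m + 1` but needs weak-Sidon and even `|Q|`);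
* `sumClique_card_sub_one_mul_card_sub_two_le` — for EVERY restricted Paley sum-clique (any size, any diagonals):
  `(|Q|−1)(|Q|−2) ≤ p − 1` (bad point: Yip, deleting a point when `|Q|` is even; no bad point: Hanson–Petridis on
  `Q ∖ {0}`), the same `√p + 3/2` as completion's `(|Q|−2)² + |Q| ≤ p` (p140731) — by the polynomial method.

Reading for the crux (with the exhaustive-rank census of this seat, kit j025830: on TRUE anti-diagonal cliques the
Stepanov–HP auxiliary spaces carry NO identity beyond the naive count, while good-diagonal cliques show the HP anomaly
every time): on restricted sum-cliques the polynomial method reaches the counting bound EXACTLY — provably from below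
(this file) and empirically not beyond (the census).  (CORE) needs `|Q| ≤ √p − p^δ/2`; nothing here touches it.
-/

-- `Summit.ValiantsHypothesis.ValiantsHypothesis.…` is the tree's mandated single-conjunct layout (Sub = Summit).
set_option linter.dupNamespace false

namespace Summit.ValiantsHypothesis.ValiantsHypothesis.Theorems.CharPSparseSOSTwoCusp

open Finset
open Literature.Combinatorics.Additive.Yip

/-- Euler's criterion, converse direction in the `legendreSym p x.val` vocabulary: if `x ≠ 0` and `x ^ ((p−1)/2) = 1`
then `(x|p) = 1`. -/
theorem scs_legendreSym_val_eq_one_of_pow_div_two {p : ℕ} [Fact p.Prime] (x : ZMod p) (hx : x ≠ 0)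
    (h : x ^ (p / 2) = 1) : legendreSym p x.val = 1 := by
  have hsq : IsSquare x := (ZMod.euler_criterion p hx).mpr h
  have hx' : ((x.val : ℤ) : ZMod p) ≠ 0 := by rwa [Int.cast_natCast, ZMod.natCast_zmod_val]
  rw [legendreSym.eq_one_iff p hx', Int.cast_natCast, ZMod.natCast_zmod_val]
  exact hsq

/-- **Yip's bound for restricted Paley sum-cliques** [cite: Yip2025, Prop. 3.1].  Let `p` be an odd prime and
`Q ⊆ 𝔽_p` a restricted sum-clique — `(a + b|p) = 1` for all `a ≠ b` in `Q` — of ODD size, with at least one point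
`a ≠ 0` whose diagonal is bad (`(2a|p) ≠ 1`).  Then `|Q|(|Q|−1)/2 + |Q⁺| ≤ (p−1)/2`, `Q⁺ = {a ∈ Q : (2a|p) = 1}`:
the weak-Sidon counting bound WITHOUT the Sidon hypothesis, plus one unit per good diagonal. -/
theorem sumClique_choose_two_add_card_good_le :
    ∀ {p : ℕ} [Fact p.Prime], p ≠ 2 → ∀ (Q : Finset (ZMod p)),
      (∀ a ∈ Q, ∀ b ∈ Q, a ≠ b → legendreSym p (a + b).val = 1) → Odd Q.card →
      (∃ a ∈ Q, a ≠ 0 ∧ legendreSym p (a + a).val ≠ 1) →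
      Q.card * (Q.card - 1) / 2 + (Q.filter fun a => legendreSym p (a + a).val = 1).card ≤ p / 2 := by
  intro p _ hp2 Q hclique hodd hbad
  classical
  have hQ : ∀ a ∈ Q, ∀ b ∈ Q, a ≠ b → (a + b) ^ (p / 2) = 1 :=
    fun a ha b hb hab => pow_div_two_eq_one_of_legendreSym_val _ (hclique a ha b hb hab)
  have htwo : (2 : ZMod p) ≠ 0 := Literature.NumberTheory.QuadraticFields.Quadratic.two_ne_zero_zmod hp2
  obtain ⟨a, ha, ha0, hbadL⟩ := hbad
  have hbad' : ∃ b₀ ∈ Q, 2 * b₀ ≠ 0 ∧ (2 * b₀) ^ (p / 2) ≠ 1 := by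
    refine ⟨a, ha, mul_ne_zero htwo ha0, fun h => hbadL ?_⟩
    rw [← two_mul]
    exact scs_legendreSym_val_eq_one_of_pow_div_two _ (mul_ne_zero htwo ha0) h
  have h := choose_two_add_card_good_le_of_restrictedSumset_subset_quadraticResidues Q hQ hodd hbad'
  have hmono : (Q.filter fun a => legendreSym p (a + a).val = 1).card ≤
      (Q.filter fun a => 2 * a = 0 ∨ (2 * a) ^ (p / 2) = 1).card := by
    apply Finset.card_le_card
    intro x hx
    rw [mem_filter] at hx ⊢
    refine ⟨hx.1, Or.inr ?_⟩
    rw [two_mul]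
    exact pow_div_two_eq_one_of_legendreSym_val _ hx.2
  set T := Q.card * (Q.card - 1) / 2
  omega

/-- **Near-extremal restricted sum-cliques are anti-diagonal, Sidon-free.**  If a restricted Paley sum-clique of odd
size with a bad diagonal is within `m` of the counting bound, `(p−1)/2 ≤ |Q|(|Q|−1)/2 + m`, then it has at most `m`
points with a good diagonal: `|Q⁺| ≤ m`.  (Parity gives `2|Q⁺| ≤ m + 1`, but only for weak-Sidon cliques of even size,
`sumClique_parity_even`, p149597.)  For (CORE)'s residual: a counting-extremal clique has `m ≈ (√p − |Q|)√p`, so below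
`|Q| = √p − p^δ/2` the good class has at most `≈ p^{1/2+δ}/2` — no constraint — while AT the counting bound `Q⁺` is
empty up to `O(1)` points. -/
theorem sumClique_card_good_le_deficiency {p : ℕ} [Fact p.Prime] (hp2 : p ≠ 2) (Q : Finset (ZMod p)) (m : ℕ)
    (hclique : ∀ a ∈ Q, ∀ b ∈ Q, a ≠ b → legendreSym p (a + b).val = 1) (hodd : Odd Q.card)
    (hbad : ∃ a ∈ Q, a ≠ 0 ∧ legendreSym p (a + a).val ≠ 1) (hnear : p / 2 ≤ Q.card * (Q.card - 1) / 2 + m) :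
    (Q.filter fun a => legendreSym p (a + a).val = 1).card ≤ m := by
  have h := sumClique_choose_two_add_card_good_le hp2 Q hclique hodd hbad
  set T := Q.card * (Q.card - 1) / 2
  omega

/-- **Even size, by deleting a point.**  A restricted Paley sum-clique of EVEN size with a bad diagonal at `a ≠ 0`
satisfies `(|Q|−1)(|Q|−2)/2 + |Q⁺| ≤ (p−1)/2 + 1` (apply the odd case to `Q` minus a point other than `a`). -/
theorem sumClique_even_choose_two_add_card_good_le {p : ℕ} [Fact p.Prime] (hp2 : p ≠ 2) (Q : Finset (ZMod p))
    (hclique : ∀ a ∈ Q, ∀ b ∈ Q, a ≠ b → legendreSym p (a + b).val = 1) (heven : Even Q.card)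
    (hbad : ∃ a ∈ Q, a ≠ 0 ∧ legendreSym p (a + a).val ≠ 1) :
    (Q.card - 1) * (Q.card - 2) / 2 + (Q.filter fun a => legendreSym p (a + a).val = 1).card ≤ p / 2 + 1 := by
  classical
  obtain ⟨a, ha, ha0, hbadL⟩ := hbad
  have hcard : 2 ≤ Q.card := by
    obtain ⟨r, hr⟩ := heven
    have : 0 < Q.card := Finset.card_pos.mpr ⟨a, ha⟩
    omega
  obtain ⟨x, hx, hxa⟩ : ∃ x ∈ Q, x ≠ a := by
    by_contra h
    push Not at h
    have hsub : Q ⊆ {a} := fun y hy => mem_singleton.mpr (h y hy)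
    have := card_le_card hsub
    rw [card_singleton] at this
    omega
  set Q' := Q.erase x with hQ'
  have ha' : a ∈ Q' := mem_erase.mpr ⟨hxa.symm, ha⟩
  have hcard' : Q'.card = Q.card - 1 := card_erase_of_mem hx
  have hodd' : Odd Q'.card := by
    rw [hcard']
    obtain ⟨r, hr⟩ := heven
    exact ⟨r - 1, by omega⟩
  have hclique' : ∀ a ∈ Q', ∀ b ∈ Q', a ≠ b → legendreSym p (a + b).val = 1 :=
    fun a ha b hb h => hclique a (mem_of_mem_erase ha) b (mem_of_mem_erase hb) h
  have h := sumClique_choose_two_add_card_good_le hp2 Q' hclique' hodd' ⟨a, ha', ha0, hbadL⟩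
  rw [hcard'] at h
  have hfilter : (Q.filter fun a => legendreSym p (a + a).val = 1).card ≤
      (Q'.filter fun a => legendreSym p (a + a).val = 1).card + 1 := by
    rw [hQ', Finset.filter_erase]
    have := Finset.pred_card_le_card_erase (s := Q.filter fun a => legendreSym p (a + a).val = 1) (a := x)
    omega
  rw [show Q.card - 1 - 1 = Q.card - 2 by omega] at h
  set T := (Q.card - 1) * (Q.card - 2) / 2
  omega

/-- **Uniform Sidon-free bound by the polynomial method.**  Every restricted Paley sum-clique `Q ⊆ 𝔽_p` (`p` an odd
prime; `(a + b|p) = 1` for all `a ≠ b` in `Q`; the diagonal free) satisfies `(|Q|−1)(|Q|−2) ≤ p − 1`, i.e.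
`|Q| < √p + 3/2` — by Stepanov's method alone: a bad diagonal gives Yip's bound (odd size) or its even-size
corollary, and when every non-zero point has a good diagonal, Hanson–Petridis applied to `Q ∖ {0}`
(`sumClique_card_sq_le_of_all_good`, p139743) gives `(|Q|−1)² ≤ (p−1)/2`.  Completion gives `(|Q|−2)² + |Q| ≤ p`
(`sumClique_completion_bound`, p140731): the two methods meet at the counting scale. -/
theorem sumClique_card_sub_one_mul_card_sub_two_le :
    ∀ {p : ℕ} [Fact p.Prime], p ≠ 2 → ∀ (Q : Finset (ZMod p)),
      (∀ a ∈ Q, ∀ b ∈ Q, a ≠ b → legendreSym p (a + b).val = 1) → (Q.card - 1) * (Q.card - 2) ≤ p - 1 := by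
  intro p hp hp2 Q hclique
  classical
  have hodd : p % 2 = 1 := Nat.odd_iff.mp (hp.out.odd_of_ne_two hp2)
  -- `(q−1)(q−2)` is even
  have hev : 2 ∣ (Q.card - 1) * (Q.card - 2) := by
    rw [show Q.card - 2 = Q.card - 1 - 1 by omega]
    exact (Nat.even_mul_pred_self _).two_dvd
  have hdiv := Nat.div_mul_cancel hev
  by_cases hbad : ∃ a ∈ Q, a ≠ 0 ∧ legendreSym p (a + a).val ≠ 1
  · obtain ⟨a, ha, ha0, hbadL⟩ := hbad
    rcases Nat.even_or_odd Q.card with heven | hoddQ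
    · -- even size: delete a point other than `a` and apply the odd case
      have hcard : 2 ≤ Q.card := by
        obtain ⟨r, hr⟩ := heven
        have : 0 < Q.card := Finset.card_pos.mpr ⟨a, ha⟩
        omega
      obtain ⟨x, hx, hxa⟩ : ∃ x ∈ Q, x ≠ a := by
        by_contra h
        push Not at h
        have hsub : Q ⊆ {a} := fun y hy => mem_singleton.mpr (h y hy)
        have := card_le_card hsub
        rw [card_singleton] at this
        omega
      have ha' : a ∈ Q.erase x := mem_erase.mpr ⟨hxa.symm, ha⟩
      have hcard' : (Q.erase x).card = Q.card - 1 := card_erase_of_mem hx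
      have hodd' : Odd (Q.erase x).card := by
        rw [hcard']
        obtain ⟨r, hr⟩ := heven
        exact ⟨r - 1, by omega⟩
      have hclique' : ∀ a ∈ Q.erase x, ∀ b ∈ Q.erase x, a ≠ b → legendreSym p (a + b).val = 1 :=
        fun a ha b hb h => hclique a (mem_of_mem_erase ha) b (mem_of_mem_erase hb) h
      have h := sumClique_choose_two_add_card_good_le hp2 (Q.erase x) hclique' hodd' ⟨a, ha', ha0, hbadL⟩
      rw [hcard', show Q.card - 1 - 1 = Q.card - 2 by omega] at h
      set N := (Q.card - 1) * (Q.card - 2)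
      omega
    · have h := sumClique_choose_two_add_card_good_le hp2 Q hclique hoddQ ⟨a, ha, ha0, hbadL⟩
      have hev' : 2 ∣ Q.card * (Q.card - 1) := (Nat.even_mul_pred_self _).two_dvd
      have hdiv' := Nat.div_mul_cancel hev'
      have hle : (Q.card - 1) * (Q.card - 2) ≤ Q.card * (Q.card - 1) :=
        Nat.mul_le_mul (Nat.sub_le _ _) (by omega)
      set N := (Q.card - 1) * (Q.card - 2)
      set N' := Q.card * (Q.card - 1)
      omega
  · -- every non-zero point has a good diagonal: Hanson–Petridis on `Q.erase 0`
    push Not at hbad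
    have hclique' : ∀ a ∈ Q.erase 0, ∀ b ∈ Q.erase 0, a ≠ b → legendreSym p (a + b).val = 1 :=
      fun a ha b hb h => hclique a (mem_of_mem_erase ha) b (mem_of_mem_erase hb) h
    have hgood : ∀ a ∈ Q.erase 0, legendreSym p (a + a).val = 1 := by
      intro a ha
      rw [mem_erase] at ha
      exact hbad a ha.2 ha.1
    have h := sumClique_card_sq_le_of_all_good hp2 (Q.erase 0) hclique' hgood
    have hcard : Q.card - 1 ≤ (Q.erase 0).card := pred_card_le_card_erase
    have h1 : (Q.card - 1) * (Q.card - 2) ≤ (Q.erase 0).card * (Q.erase 0).card :=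
      Nat.mul_le_mul hcard (le_trans (by omega) hcard)
    set N := (Q.card - 1) * (Q.card - 2)
    set M := (Q.erase 0).card * (Q.erase 0).card
    omega

end Summit.ValiantsHypothesis.ValiantsHypothesis.Theorems.CharPSparseSOSTwoCusp
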